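import Literature.NumberTheory.EllipticCurves.Rank1Residual.Typed.VisibilityLowerHalf
import Literature.NumberTheory.EllipticCurves.Rank1Residual.PrintShape
import Literature.NumberTheory.EllipticCurves.MordellWeilProofs
import HarnessLib

/-!
# Route `ErratumRoadFive` (rung K2, `p ≥ 5`), crux `RamNoErratumDataAtFive` (item stmt-BirchSwinnertonDyer-19624, REST‴),
# residual branch (D) `Rest3ShaDivisibleBranchAtFive`: the typed LOWER half `ord_p #Ш_an ≤ ord_p #Ш` at a pair of
# ANALYTIC RANK ONE from a VISIBLE element of `Ш(E)[p]` — a `p`-congruent curve of rank `≥ 2`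
# (cell `bsd-stepL`, owner seat `bsd-stepL-rest-p2` g5; `--supports stmt-BirchSwinnertonDyer-19624`; THEOREMS ONLY; Theses-FREE)

WHY. Modulo the route's two support items, crux 19624 (REST‴) is EXACTLY its branch (D): the (ram) no-erratum X11b
pairs `(E, p)` with `p ∣ #Ш(E)_an`, where the open content is the lower half `Typed.MissingLowerBoundAt E p`
(`Theorems.ramNoErratumDataAtFive_iff_rest3ShaDivisibleBranch`, p517130). Branch (D) is non-empty (seven explicit
rank-one members D0–D6 with `#Ш_an = 25`, HOME/rest/D-SEARCH.md) and no printed theorem reaches it. The ONE per-pair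
certificate road short of a full `p`-descent is VISIBILITY (Cremona–Mazur 2000, Agashe–Stein 2002 Thm. 3.1): the tree's
kernel Selmer comparison `WeierstrassCurve.exists_sha_ne_zero_of_congr_of_le_off` (Cremona–Mazur's count, place by
place) produces a non-zero element of `Ш(E)[p]` from a `Γ_ℚ`-isomorphism `θ : E'[p] ⥲ E[p]` with a curve `E'` of larger
rank, provided `[E(ℚ):pE(ℚ)] · ∏_{paid places} #𝓛_v(E') < [E'(ℚ):pE'(ℚ)]`. The tree's typed doors
(`Typed.missingLowerBoundAt_of_congr_of_rank_two`, `…_of_places`, `Typed/VisibilityLowerHalf.lean`) are written for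
analytic rank ZERO (`E(ℚ)` finite, `[E(ℚ):pE(ℚ)] = 1`). This file supplies the analytic-rank-ONE twin needed on X11b:
`[E(ℚ):pE(ℚ)] = p` (rank one by Gross–Zagier–Kolyvagin, `p ∤ #E(ℚ)_tors`), so a partner of rank `≥ 2` with all places
free — or rank `≥ 2 + #paid` — gives `Ш(E)[p] ≠ 0`, and Cassels–Tate squareness on the finite `Ш` (GZK) turns `p ∣ #Ш`
into `p² ∣ #Ш`, i.e. the lower half when `ord_p #Ш_an ≤ 2`.

CONTENTS (all sorry-free; published inputs as displayed binders — Cassels–Tate `hCT`, GZK `hGZK`, Tate uniformisation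
`hU`/`hU2` (Silverman ATAEC V.3.1/V.5.3/V.5.4); per-pair data displayed — `W'`, `θ`, `hθ`, ranks, places):
* §1 `index_range_zsmul_eq_pow_mordellWeilRank_of_coprime` — for an elliptic curve over a number field and `n ≥ 1`
  with `gcd(#E(K)_tors, n) = 1`: `[E(K) : nE(K)] = n^{rank E(K)}` (Mordell–Weil; the tree had only `≥`).
* §2 `exists_sha_ne_zero_of_congr_of_places_of_coprime_torsion` — the refined visibility count for `E` of ANY rank:
  pay `p^{rank E} · ∏_{v ∈ T} #E'(K_v)[p]·#(𝓞_v/p) < p^{rank E'}`, free kinds (i)/(ii)/(iii) on `S \ T` ⇒ `Ш(E/K)[p] ≠ 0`.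
* §3 `missingLowerBoundAt_of_congr_of_places_of_analyticRank_one` (+ `_of_irr`) — over `ℚ`, `r_an = 1`, `p` odd,
  `p ∤ #E(ℚ)_tors` (automatic for `E[p]` irreducible), `#Ш_an = q`, `ord_p q ≤ 2`, partner data ⇒
  `Typed.MissingLowerBoundAt E p`.
HONEST FRAMING: per-pair certificate doors, NOT class theorems; CONDITIONAL on the displayed published facts; the
partner data (`θ`, ranks, local kinds) are hypotheses to be supplied per curve; nothing is booked; no census word
moves (T7). Used at the (D)-witness D1 in `ErratumRoadFiveRest3DWitnessD1Visible.lean`.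

References: [CremonaMazur2000] §3, Table 1; [AgasheStein2002] Thm. 3.1, §3.5; [SilvermanAEC2009] VIII.6.7, X.4.14;
[SilvermanATAEC1994] V.3.1, V.5.3, V.5.4; [Mazur1977] III.§5; [Miller2011LMS] Def. 1.1; [GrossZagier1986]; [Kolyvagin1990].
-/

-- the Theorems namespace of this sub repeats the summit name by design (D-0017 nested layout)
set_option linter.dupNamespace false
set_option autoImplicit false

noncomputable section

open scoped Classical

open WeierstrassCurve Literature.NumberTheory.EllipticCurves
  Literature.NumberTheory.EllipticCurves.Rank1Residual
  Literature.NumberTheory.EllipticCurves.Rank1Residual.Typed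
open NumberField IsDedekindDomain

namespace Summit.BirchSwinnertonDyer.BirchSwinnertonDyer.Theorems

namespace VisibleLowerHalf

/-! ## §1 `[E(K) : nE(K)] = n^{rank}` when `gcd(#E(K)_tors, n) = 1` -/

section Index

variable {K : Type} [Field K] [NumberField K] (W : WeierstrassCurve K) [W.IsElliptic]

/-- **`[E(K) : nE(K)] = n^{rank E(K)}` for `n ≥ 1` prime to `#E(K)_{tors}`.** Mordell–Weil: `E(K)` is finitely
generated, `F = E(K)/E(K)_{tors}` is free of rank `r = rank E(K)` and `#(F/nF) = n^r` (Mathlib `ModN.natCard_eq`);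
the kernel of `E(K) → F/nF` is `nE(K) + E(K)_{tors} = nE(K)` because multiplication by `n` is onto on the finite group
`E(K)_{tors}` of order prime to `n` (`index_range_zsmul_eq_one_of_coprime`); so `[E(K):nE(K)] ≤ n^r`, and `≥` is the
tree's `pow_mordellWeilRank_le_index_range_zsmul`. [cite: SilvermanAEC2009, Thm. VIII.6.7] -/
theorem index_range_zsmul_eq_pow_mordellWeilRank_of_coprime {n : ℕ} (hn : n ≠ 0)
    (hcop : (W.torsionOrder).Coprime n) :
    (zsmulAddGroupHom (n : ℤ) : W.toAffine.Point →+ W.toAffine.Point).range.index =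
      n ^ W.mordellWeilRank := by
  haveI : NeZero n := ⟨hn⟩
  refine le_antisymm ?_ (pow_mordellWeilRank_le_index_range_zsmul W hn)
  -- Mordell–Weil: `E(K)` finitely generated, `F = E(K)/tors` free of rank `rank E(K)`, `tors` finite
  haveI : Module.Finite ℤ W.toAffine.Point := W.module_finite_point_holds
  haveI : Module.Free ℤ (mordellWeilModTorsion W) :=
    module_free_mordellWeilModTorsion W W.module_finite_point_holds
  haveI : Module.Finite ℤ (mordellWeilModTorsion W) :=
    Module.Finite.of_surjective
      ((QuotientAddGroup.mk' (AddCommGroup.torsion W.toAffine.Point)).toIntLinearMap)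
      (QuotientAddGroup.mk'_surjective (AddCommGroup.torsion W.toAffine.Point))
  have hrank : Module.finrank ℤ (mordellWeilModTorsion W) = W.mordellWeilRank :=
    finrank_mordellWeilModTorsion_eq_holds W
  set T : AddSubgroup W.toAffine.Point := AddCommGroup.torsion W.toAffine.Point with hTdef
  haveI hTfin : Finite T := W.finite_torsion_holds
  -- multiplication by `n` is onto on `T`
  have hTcop : (Nat.card T).Coprime n := hcop
  have hTonto : (zsmulAddGroupHom (n : ℤ) : T →+ T).range = ⊤ := by
    rw [← AddSubgroup.index_eq_one]
    exact index_range_zsmul_eq_one_of_coprime (p := n) hTcop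
  -- `φ : E(K) ↠ F ↠ F/nF`
  set φ : W.toAffine.Point →+ ModN (mordellWeilModTorsion W) n :=
    (ModN.mkQ (G := mordellWeilModTorsion W) n).comp (QuotientAddGroup.mk' T) with hφdef
  have hφ : Function.Surjective φ :=
    (Submodule.mkQ_surjective _).comp (QuotientAddGroup.mk'_surjective _)
  -- `ker φ ≤ nE(K)`
  have hker : φ.ker ≤ (zsmulAddGroupHom (n : ℤ) : W.toAffine.Point →+ W.toAffine.Point).range := by
    intro x hx
    rw [AddMonoidHom.mem_ker, hφdef, AddMonoidHom.coe_comp, Function.comp_apply] at hx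
    have hx' : (QuotientAddGroup.mk' T x : mordellWeilModTorsion W) ∈
        LinearMap.range (LinearMap.lsmul ℤ (mordellWeilModTorsion W) n) := by
      rw [← Submodule.Quotient.mk_eq_zero]
      exact hx
    obtain ⟨ybar, hybar⟩ := LinearMap.mem_range.mp hx'
    obtain ⟨y, rfl⟩ := QuotientAddGroup.mk'_surjective T ybar
    rw [LinearMap.lsmul_apply] at hybar
    -- `x - n • y ∈ T`
    have hmem : x - (n : ℤ) • y ∈ T := by
      rw [← QuotientAddGroup.ker_mk' T, AddMonoidHom.mem_ker, map_sub, map_zsmul, sub_eq_zero]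
      exact hybar.symm
    -- `T = nT`
    have ht : (⟨x - (n : ℤ) • y, hmem⟩ : T) ∈ (zsmulAddGroupHom (n : ℤ) : T →+ T).range := by
      rw [hTonto]; exact AddSubgroup.mem_top _
    obtain ⟨t, ht⟩ := ht
    refine ⟨y + (t : W.toAffine.Point), ?_⟩
    have ht' : (n : ℤ) • (t : W.toAffine.Point) = x - (n : ℤ) • y := by
      have := congrArg Subtype.val ht
      simpa [zsmulAddGroupHom_apply] using this
    rw [zsmulAddGroupHom_apply, zsmul_add, ht', add_sub_cancel]
  -- count
  have hidxφ : φ.ker.index = n ^ W.mordellWeilRank := by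
    rw [AddSubgroup.index_ker φ, AddMonoidHom.range_eq_top.mpr hφ, AddSubgroup.card_top, ModN.natCard_eq, hrank]
  have hdvd := AddSubgroup.index_dvd_of_le hker
  rw [hidxφ] at hdvd
  exact Nat.le_of_dvd (pow_pos (Nat.pos_of_ne_zero hn) _) hdvd

end Index

/-! ## §2 The refined visibility count for `E` of any rank -/

section Count

variable {K : Type} [Field K] [NumberField K] (W : WeierstrassCurve K) [W.IsElliptic]
  {p : ℕ} [hp : Fact p.Prime]

/-- **Visible `Ш(E/K)[p] ≠ 0` from a `p`-congruent curve, refined count, `E` of ANY rank.** Let `p` be an odd prime,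
`θ : E'[p] ⥲ E[p]` a `Γ_K`-isomorphism, `T ⊆ S` finite sets of finite places with both curves of good reduction and
`v ∤ p` outside `S`, and `gcd(#E(K)_tors, p) = 1`. Suppose (a) `p^{rank E(K)} · ∏_{v ∈ T} #E'(K_v)[p]·#(𝓞_v/p) <
p^{rank E'(K)}` (the PAID places) and (b) every `v ∈ S \ T` is free: (i) `v ∤ p` and `E'(K_v)[p] = 0`; (ii) both
curves split multiplicative at `v` with `#E(K_v)[p] ≤ p`; (iii) both multiplicative, `γ(E) = r²γ(E')` in `K_v`,
`μ_p(K_v) = 1`. Then `Ш(E/K)` has a non-zero element killed by `p` (`exists_sha_ne_zero_of_congr_of_le_off` with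
`[E(K):pE(K)] = p^{rank E(K)}` from §1 and `p^{rank E'} ≤ [E'(K):pE'(K)]`). The tree's
`exists_sha_ne_zero_of_congr_of_places` is the case `rank E(K) = 0`. Conditional on Tate's uniformisation (`hU`,
`hU2`). [cite: CremonaMazur2000, §3 and Table 1] [cite: AgasheStein2002, Thm. 3.1 and §3.5]
[cite: SilvermanATAEC1994, Ch. V Thm. 3.1, Thm. 5.3, Cor. 5.4] -/
theorem exists_sha_ne_zero_of_congr_of_places_of_coprime_torsion
    (hU : Silverman1994_thmV53_tateUniformisation.{0})
    (hU2 : Silverman1994_thmV53_corV54_tateUniformisation.{0}) (hp2 : p ≠ 2)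
    (W' : WeierstrassCurve K) [W'.IsElliptic]
    (θ : geomTorsion W' (p : ℤ) ≃+ geomTorsion W (p : ℤ))
    (hθ : ∀ (σ : Field.absoluteGaloisGroup K) (P : geomTorsion W' (p : ℤ)), θ (σ • P) = σ • θ P)
    (S T : Finset (HeightOneSpectrum (𝓞 K))) (hTS : T ⊆ S)
    (hS : ∀ w : HeightOneSpectrum (𝓞 K), w ∉ S →
      W.HasGoodReductionAt w ∧ W'.HasGoodReductionAt w ∧ (p : 𝓞 K) ∉ w.asIdeal)
    (hcop : (W.torsionOrder).Coprime p)
    (hT : p ^ W.mordellWeilRank * (∏ w ∈ T, Nat.card (nsmulAddMonoidHom p :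
        (W'.baseChange (w.adicCompletion K)).toAffine.Point →+ _).ker *
        Nat.card (w.adicCompletionIntegers K ⧸
          Ideal.span {(p : w.adicCompletionIntegers K)})) < p ^ W'.mordellWeilRank)
    (hplaces : ∀ w ∈ S, w ∉ T →
      ((p : 𝓞 K) ∉ w.asIdeal ∧ Nat.card (nsmulAddMonoidHom p :
          (W'.baseChange (w.adicCompletion K)).toAffine.Point →+ _).ker = 1) ∨
      (W.HasSplitMultiplicativeReductionAt w ∧ W'.HasSplitMultiplicativeReductionAt w ∧
        Nat.card (nsmulAddMonoidHom p :
          (W.baseChange (w.adicCompletion K)).toAffine.Point →+ _).ker ≤ p) ∨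
      (W.HasMultiplicativeReductionAt w ∧ W'.HasMultiplicativeReductionAt w ∧
        (∃ r : w.adicCompletion K, algebraMap K (w.adicCompletion K) (-(W.c₄ / W.c₆)) =
          r ^ 2 * algebraMap K (w.adicCompletion K) (-(W'.c₄ / W'.c₆))) ∧
        (∀ ζ : w.adicCompletion K, ζ ^ p = 1 → ζ = 1))) :
    ∃ c : W.sha, c ≠ 0 ∧ p • c = 0 := by
  have hpp : p.Prime := hp.out
  refine exists_sha_ne_zero_of_congr_of_le_off W W' hp2 θ hθ S T hTS hS (fun w hw hwT c hc ↦ ?_) ?_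
  · rcases hplaces w hw hwT with ⟨hwp, hloc⟩ | ⟨hWw, hW'w, hcardw⟩ | ⟨hWw, hW'w, hγw, hμw⟩
    · exact (relIndex_map_selmerLocalKer_eq_one_iff W W' θ hθ).mp
        (relIndex_map_selmerLocalKer_eq_one_of_card_torsion_eq_one W W' θ hθ hwp hloc) c hc
    · exact W.h1Equiv_mem_selmerLocalKer_of_hasSplitMultiplicativeReductionAt w hU W' θ hθ hWw
        hW'w hcardw hc
    · exact W.h1Equiv_mem_selmerLocalKer_of_hasMultiplicativeReductionAt w hU2 hp2 W' θ hθ hWw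
        hW'w hγw hμw hc
  · rw [index_range_zsmul_eq_pow_mordellWeilRank_of_coprime W hpp.ne_zero hcop,
      Finset.prod_congr rfl fun w _ ↦
        (W'.natCard_kummerLocalConditionAt_adicCompletion w hpp.ne_zero)]
    exact lt_of_lt_of_le hT (pow_mordellWeilRank_le_index_range_zsmul W' hpp.ne_zero)

end Count

/-! ## §3 Over `ℚ` at analytic rank ONE: the typed lower half -/

section RankOne

variable (W : WeierstrassCurve ℚ) [W.IsElliptic] (p : ℕ) [hp : Fact p.Prime]

/-- `gcd(#E(ℚ)_tors, p) = 1` when `E[p]` is irreducible (a rational point of order `p` spans a `Γ_ℚ`-stable line;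
Mazur 1977 p. 157; tree `padicValNat_torsionOrder_eq_zero_of_irreducible`). [cite: Mazur1977, Ch. III §5, p. 157] -/
theorem coprime_torsionOrder_of_irr (hirr : Irr W p) : (W.torsionOrder).Coprime p := by
  have hp' : p.Prime := hp.out
  have h0 : padicValNat p W.torsionOrder = 0 := padicValNat_torsionOrder_eq_zero_of_irreducible W p hirr
  have hne : W.torsionOrder ≠ 0 := (WeierstrassCurve.torsionOrder_pos_holds W).ne'
  rcases padicValNat.eq_zero_iff.mp h0 with h | h | h
  · exact absurd h hp'.one_lt.ne'
  · exact absurd h hne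
  · exact (Nat.Prime.coprime_iff_not_dvd hp').mpr h |>.symm

/-- **Lower half at an analytic-rank-ONE pair from a visible element, refined count.** `E = W` over `ℚ` with
`r_an(E) = 1` (so `rank E(ℚ) = 1` and `Ш(E)` finite, GZK `hGZK`), `p` odd, `gcd(#E(ℚ)_tors, p) = 1`, `#Ш(E)_an = q`
rational with `ord_p q ≤ 2`; a `Γ_ℚ`-isomorphism `θ : E'[p] ⥲ E[p]` from an elliptic curve `E' = W'`; finite sets of
finite places `T ⊆ S` (outside `S`: both good, `v ∤ p`) with `p · ∏_{v∈T} #E'(ℚ_v)[p]·#(ℤ_v/p) < p^{rank E'(ℚ)}` and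
every place of `S \ T` of a free kind (i)/(ii)/(iii). Then `ord_p #Ш(E)_an ≤ ord_p #Ш(E)` (`Typed.MissingLowerBoundAt
W p`): §2 gives `Ш(E)[p] ≠ 0`, Cassels–Tate (`hCT`) squareness gives `p² ∣ #Ш`. With all places free the partner
needs rank `≥ 2`. PER PAIR; not a class theorem; conditional on the displayed facts. [cite: CremonaMazur2000, §3]
[cite: AgasheStein2002, Thm. 3.1 and §3.5] [cite: SilvermanAEC2009, Thm. X.4.14] [cite: SilvermanATAEC1994, Ch. V
Thm. 5.3, Cor. 5.4] [cite: Miller2011LMS, Def. 1.1 (arXiv:1010.2431 p. 3)] -/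
theorem missingLowerBoundAt_of_congr_of_places_of_analyticRank_one
    (hCT : exists_casselsTate_pairing (K := ℚ)) (hGZK : rank_eq_analyticRank_of_analyticRank_le_one)
    (hU : Silverman1994_thmV53_tateUniformisation.{0})
    (hU2 : Silverman1994_thmV53_corV54_tateUniformisation.{0}) (hp2 : p ≠ 2)
    (hr : W.analyticRank = 1) (hcop : (W.torsionOrder).Coprime p)
    {q : ℚ} (hq : shaAn W = (q : ℂ)) (hv : padicValRat p q ≤ 2)
    (W' : WeierstrassCurve ℚ) [W'.IsElliptic]
    (θ : geomTorsion W' (p : ℤ) ≃+ geomTorsion W (p : ℤ))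
    (hθ : ∀ (σ : Field.absoluteGaloisGroup ℚ) (P : geomTorsion W' (p : ℤ)), θ (σ • P) = σ • θ P)
    (S T : Finset (HeightOneSpectrum (𝓞 ℚ))) (hTS : T ⊆ S)
    (hS : ∀ v : HeightOneSpectrum (𝓞 ℚ), v ∉ S →
      W.HasGoodReductionAt v ∧ W'.HasGoodReductionAt v ∧ (p : 𝓞 ℚ) ∉ v.asIdeal)
    (hT : p * (∏ v ∈ T, Nat.card (nsmulAddMonoidHom p :
        (W'.baseChange (v.adicCompletion ℚ)).toAffine.Point →+ _).ker *
        Nat.card (v.adicCompletionIntegers ℚ ⧸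
          Ideal.span {(p : v.adicCompletionIntegers ℚ)})) < p ^ W'.mordellWeilRank)
    (hplaces : ∀ v ∈ S, v ∉ T →
      ((p : 𝓞 ℚ) ∉ v.asIdeal ∧ Nat.card (nsmulAddMonoidHom p :
          (W'.baseChange (v.adicCompletion ℚ)).toAffine.Point →+ _).ker = 1) ∨
      (W.HasSplitMultiplicativeReductionAt v ∧ W'.HasSplitMultiplicativeReductionAt v ∧
        Nat.card (nsmulAddMonoidHom p :
          (W.baseChange (v.adicCompletion ℚ)).toAffine.Point →+ _).ker ≤ p) ∨
      (W.HasMultiplicativeReductionAt v ∧ W'.HasMultiplicativeReductionAt v ∧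
        (∃ r : v.adicCompletion ℚ, algebraMap ℚ (v.adicCompletion ℚ) (-(W.c₄ / W.c₆)) =
          r ^ 2 * algebraMap ℚ (v.adicCompletion ℚ) (-(W'.c₄ / W'.c₆))) ∧
        (∀ ζ : v.adicCompletion ℚ, ζ ^ p = 1 → ζ = 1))) :
    MissingLowerBoundAt W p := by
  have hrk : W.mordellWeilRank = 1 := (hGZK W (by omega)).1.trans hr
  have hfin : W.ShaFinite := (hGZK W (by omega)).2
  have hT' : p ^ W.mordellWeilRank * (∏ v ∈ T, Nat.card (nsmulAddMonoidHom p :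
        (W'.baseChange (v.adicCompletion ℚ)).toAffine.Point →+ _).ker *
        Nat.card (v.adicCompletionIntegers ℚ ⧸
          Ideal.span {(p : v.adicCompletionIntegers ℚ)})) < p ^ W'.mordellWeilRank := by
    rwa [hrk, pow_one]
  have hdvd : p ∣ W.shaOrder :=
    dvd_shaOrder_of_exists_torsion W p
      (exists_sha_ne_zero_of_congr_of_places_of_coprime_torsion W hU hU2 hp2 W' θ hθ S T hTS hS
        hcop hT' hplaces)
  exact missingLowerBoundAt_of_casselsTate_of_pow_dvd W p hCT hfin hq (k := 1)
    (by simpa using hv) (by simpa using hdvd)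

/-- **Lower half at an analytic-rank-ONE pair from a visible element, all places free, partner of rank `≥ 2`.**
The shape met at the (D)-witness D1: `T = ∅`. [cite: CremonaMazur2000, §3 and Table 1]
[cite: AgasheStein2002, Thm. 3.1 and §3.5] [cite: SilvermanAEC2009, Thm. X.4.14] -/
theorem missingLowerBoundAt_of_congr_of_rank_two_of_analyticRank_one
    (hCT : exists_casselsTate_pairing (K := ℚ)) (hGZK : rank_eq_analyticRank_of_analyticRank_le_one)
    (hU : Silverman1994_thmV53_tateUniformisation.{0})
    (hU2 : Silverman1994_thmV53_corV54_tateUniformisation.{0}) (hp2 : p ≠ 2)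
    (hr : W.analyticRank = 1) (hcop : (W.torsionOrder).Coprime p)
    {q : ℚ} (hq : shaAn W = (q : ℂ)) (hv : padicValRat p q ≤ 2)
    (W' : WeierstrassCurve ℚ) [W'.IsElliptic]
    (θ : geomTorsion W' (p : ℤ) ≃+ geomTorsion W (p : ℤ))
    (hθ : ∀ (σ : Field.absoluteGaloisGroup ℚ) (P : geomTorsion W' (p : ℤ)), θ (σ • P) = σ • θ P)
    (hrank : 2 ≤ W'.mordellWeilRank)
    (S : Finset (HeightOneSpectrum (𝓞 ℚ)))
    (hS : ∀ v : HeightOneSpectrum (𝓞 ℚ), v ∉ S →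
      W.HasGoodReductionAt v ∧ W'.HasGoodReductionAt v ∧ (p : 𝓞 ℚ) ∉ v.asIdeal)
    (hplaces : ∀ v ∈ S,
      ((p : 𝓞 ℚ) ∉ v.asIdeal ∧ Nat.card (nsmulAddMonoidHom p :
          (W'.baseChange (v.adicCompletion ℚ)).toAffine.Point →+ _).ker = 1) ∨
      (W.HasSplitMultiplicativeReductionAt v ∧ W'.HasSplitMultiplicativeReductionAt v ∧
        Nat.card (nsmulAddMonoidHom p :
          (W.baseChange (v.adicCompletion ℚ)).toAffine.Point →+ _).ker ≤ p) ∨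
      (W.HasMultiplicativeReductionAt v ∧ W'.HasMultiplicativeReductionAt v ∧
        (∃ r : v.adicCompletion ℚ, algebraMap ℚ (v.adicCompletion ℚ) (-(W.c₄ / W.c₆)) =
          r ^ 2 * algebraMap ℚ (v.adicCompletion ℚ) (-(W'.c₄ / W'.c₆))) ∧
        (∀ ζ : v.adicCompletion ℚ, ζ ^ p = 1 → ζ = 1))) :
    MissingLowerBoundAt W p := by
  have hpp : p.Prime := hp.out
  refine missingLowerBoundAt_of_congr_of_places_of_analyticRank_one W p hCT hGZK hU hU2 hp2 hr hcop hq hv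
    W' θ hθ S ∅ (Finset.empty_subset S) hS ?_ (fun v hv _ ↦ hplaces v hv)
  rw [Finset.prod_empty, mul_one]
  calc p = p ^ 1 := (pow_one p).symm
    _ < p ^ 2 := Nat.pow_lt_pow_right hpp.one_lt (by norm_num)
    _ ≤ p ^ W'.mordellWeilRank := Nat.pow_le_pow_right hpp.pos hrank

/-- The same with `gcd(#E(ℚ)_tors, p) = 1` discharged by `E[p]` irreducible (the X11b situation: `ρ̄_{E,p}` onto).
[cite: Mazur1977, Ch. III §5, p. 157] [cite: CremonaMazur2000, §3] [cite: AgasheStein2002, Thm. 3.1] -/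
theorem missingLowerBoundAt_of_congr_of_rank_two_of_analyticRank_one_of_irr
    (hCT : exists_casselsTate_pairing (K := ℚ)) (hGZK : rank_eq_analyticRank_of_analyticRank_le_one)
    (hU : Silverman1994_thmV53_tateUniformisation.{0})
    (hU2 : Silverman1994_thmV53_corV54_tateUniformisation.{0}) (hp2 : p ≠ 2)
    (hr : W.analyticRank = 1) (hirr : Irr W p)
    {q : ℚ} (hq : shaAn W = (q : ℂ)) (hv : padicValRat p q ≤ 2)
    (W' : WeierstrassCurve ℚ) [W'.IsElliptic]
    (θ : geomTorsion W' (p : ℤ) ≃+ geomTorsion W (p : ℤ))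
    (hθ : ∀ (σ : Field.absoluteGaloisGroup ℚ) (P : geomTorsion W' (p : ℤ)), θ (σ • P) = σ • θ P)
    (hrank : 2 ≤ W'.mordellWeilRank)
    (S : Finset (HeightOneSpectrum (𝓞 ℚ)))
    (hS : ∀ v : HeightOneSpectrum (𝓞 ℚ), v ∉ S →
      W.HasGoodReductionAt v ∧ W'.HasGoodReductionAt v ∧ (p : 𝓞 ℚ) ∉ v.asIdeal)
    (hplaces : ∀ v ∈ S,
      ((p : 𝓞 ℚ) ∉ v.asIdeal ∧ Nat.card (nsmulAddMonoidHom p :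
          (W'.baseChange (v.adicCompletion ℚ)).toAffine.Point →+ _).ker = 1) ∨
      (W.HasSplitMultiplicativeReductionAt v ∧ W'.HasSplitMultiplicativeReductionAt v ∧
        Nat.card (nsmulAddMonoidHom p :
          (W.baseChange (v.adicCompletion ℚ)).toAffine.Point →+ _).ker ≤ p) ∨
      (W.HasMultiplicativeReductionAt v ∧ W'.HasMultiplicativeReductionAt v ∧
        (∃ r : v.adicCompletion ℚ, algebraMap ℚ (v.adicCompletion ℚ) (-(W.c₄ / W.c₆)) =
          r ^ 2 * algebraMap ℚ (v.adicCompletion ℚ) (-(W'.c₄ / W'.c₆))) ∧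
        (∀ ζ : v.adicCompletion ℚ, ζ ^ p = 1 → ζ = 1))) :
    MissingLowerBoundAt W p :=
  missingLowerBoundAt_of_congr_of_rank_two_of_analyticRank_one W p hCT hGZK hU hU2 hp2 hr
    (coprime_torsionOrder_of_irr W p hirr) hq hv W' θ hθ hrank S hS hplaces

end RankOne

end VisibleLowerHalf

end Summit.BirchSwinnertonDyer.BirchSwinnertonDyer.Theorems

end
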